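import Summits.Ventures.HSemireg.WedgeHankelRecurrenceSubstitutions

/-!
# Venture HSemireg — INVERSION EXCHANGES THE NODE `0` AND THE NODE `∞`: reversing the coefficients (`rev_N q`, the substitution `t ↦ 1/t`) keeps the middle rank, **`R(rev_N q) = R(q)`**,
# reflects the minimal recurrence, **`Rec_r(rev_N q) = K · reflect_r m`** (`Rec_r(q) = K · m`), and therefore **`X^e ∣ m` (the node `0` with multiplicity `≥ e`) iff the minimal recurrence of
# `rev_N q` has degree `≤ r − e` (a polar part of order `≥ e` at infinity)** — the degree drop of N18/N26/N29 is an honest node, seen through the chart at infinity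

HONEST FRAMING. Part of the Lean index of the computation cell `pub-hsemireg` (seat p10 gen 27, Sunday typer «UNIFORM-IN-n»).
LINEAR ALGEBRA OF HANKEL (catalecticant) MATRICES and of polynomials over a field ONLY (`Polynomial.reflect`): no variety, no cohomology theory, no sheaf, no Ext group and no
semiregularity map is constructed here; nothing here says that HC / HC_CM / HC_AV holds; no Literature fact is declared or used.  Custodian versions as in `WedgeHankelSiegelIdeal` (1/3); the
dictionary (`rev_N` = the involution `x_a ↔ y_a` / `t ↦ 1/t` of E7; `reflect_r m(X) = X^r m(1/X)`; «order at `0`» = multiplicity of the root `0` of the minimal recurrence, «order at `∞`» = its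
degree drop below `R(q)`) is QUOTED, never asserted.

WHAT IS IN THE TREE.  N22 (`WedgeHankelRecurrenceSubstitutions`, № 175): `mem_recSpace_rev_iff` (`deg p ≤ k`: `p ∈ Rec_k(rev_N q) ↔ reflect_k p ∈ Rec_k(q)`), `one_mem_recSpace_rev_iff`;
E7 (`WedgeHankelSwap`) `rev`; E12 (`WedgeHankelScale`) `rank_hankel1_rev` (`rank H_k(rev_N q) = rank H_k(q)`, not restated); N18 (№ 173): `recSpace`, `hankel1`, `finrank_recSpace_self`, `exists_recSpace_self_eq_span`, `natDegree_le_of_mem_recSpace`,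
`recSpace_le_degreeLT`, `mem_degreeLT_succ_iff`.  Mathlib: `Polynomial.reflect` (`coeff_reflect`, `revAt_invol`, `revAt_le`, `reflect_add`, `reflect_C_mul`, `natDegree_reflect_le`),
`Polynomial.X_pow_dvd_iff`.
THIS FILE (namespace `Summit.Ventures.HSemireg.Wedge.HankelOuter` continued; PLAIN over the tree; 0 definitions):
* §523 `polynomial_reflect_reflect` (`reflect_k` is an involution), `reflect_smul`, **`rank_hankel1_half_rev`** (`R(rev_N q) = R(q)`, E12 read in the middle degree).
* §524 **`recSpace_rev_eq_span_reflect`** (`Rec_k(q) = K · m`, `deg m ≤ k ⇒ Rec_k(rev_N q) = K · reflect_k m`), `recSpace_rev_self_eq_span_reflect` (the minimal-recurrence line of `rev_N q`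
  is the reflected line).
* §525 `natDegree_reflect_add_le_iff_X_pow_dvd` (`deg m ≤ r`, `e ≤ r`: `deg(reflect_r m) + e ≤ r ↔ X^e ∣ m` — coefficient bookkeeping), **`X_pow_dvd_iff_exists_mem_recSpace_rev`**
  (`R(q) = r`, `2r ≤ N + 1`, `0 ≠ m ∈ Rec_r(q)`, `e ≤ r`: `X^e ∣ m ↔` some non-zero recurrence of `rev_N q` of window `r + 1` has degree `≤ r − e`): THE MULTIPLICITY OF THE NODE `0` OF `q`
  IS THE ORDER AT INFINITY OF `rev_N q`.
READING: N22 gave the inversion law for single recurrences; with N18's uniqueness of the minimal recurrence it becomes a statement about classes: inversion preserves the middle rank,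
reflects the minimal polynomial, and trades the root `0` (with multiplicity) for the degree drop — so the «polar part at infinity» of the structure theorems is the image of an ordinary
affine node under `t ↦ 1/t`, as the dictionary says.  Nothing Ext-side.  New names only.
-/

open Module Polynomial
open scoped Matrix Polynomial

namespace Summit.Ventures.HSemireg.Wedge.HankelOuter

open Summit.Ventures.HSemireg.Wedge Summit.Ventures.HSemireg.Wedge.Hankel Summit.Ventures.HSemireg.Wedge.HankelFrameChange

variable (K : Type*) [Field K] {N : ℕ}

/-! ## §523. Reflection is an involution; reversal keeps the middle rank -/

/-- `reflect_k` is an involution. -/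
theorem polynomial_reflect_reflect (k : ℕ) (p : K[X]) : Polynomial.reflect k (Polynomial.reflect k p) = p := by
  ext i; rw [Polynomial.coeff_reflect, Polynomial.coeff_reflect, Polynomial.revAt_invol]

/-- `reflect_k (c • p) = c • reflect_k p`. -/
theorem reflect_smul (k : ℕ) (c : K) (p : K[X]) : Polynomial.reflect k (c • p) = c • Polynomial.reflect k p := by
  rw [← Polynomial.C_mul', Polynomial.reflect_C_mul, Polynomial.C_mul']

/-- **INVERSION KEEPS THE MIDDLE RANK: `R(rev_N q) = R(q)`** (E12's `rank_hankel1_rev` — every catalecticant rank is kept — read in the middle degree). -/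
theorem rank_hankel1_half_rev (q : ℕ → K) : (hankel1 K N (N / 2) (rev K N q)).rank = (hankel1 K N (N / 2) q).rank :=
  rank_hankel1_rev K (N / 2) q

/-! ## §524. Inversion reflects the minimal recurrence -/

/-- **`Rec_k(q) = K · m` with `deg m ≤ k` ⇒ `Rec_k(rev_N q) = K · reflect_k m`** (N22's inversion law on the line). -/
theorem recSpace_rev_eq_span_reflect {k : ℕ} {q : ℕ → K} {m : K[X]} (hm : recSpace K N q k = K ∙ m) (hmk : m.natDegree ≤ k) :
    recSpace K N (rev K N q) k = K ∙ Polynomial.reflect k m := by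
  have hrefl : ∀ {p : K[X]}, p.natDegree ≤ k → Polynomial.reflect k p ∈ Polynomial.degreeLT K (k + 1) :=
    fun hp => (mem_degreeLT_succ_iff K).mpr (Polynomial.natDegree_reflect_le.trans (max_le le_rfl hp))
  ext p
  constructor
  · intro hp
    have hdeg := recSpace_le_degreeLT K _ k hp
    have h := (mem_recSpace_rev_iff K k q hdeg).mp hp
    rw [hm, Submodule.mem_span_singleton] at h
    obtain ⟨c, hc⟩ := h
    rw [Submodule.mem_span_singleton]
    exact ⟨c, by rw [← reflect_smul, hc, polynomial_reflect_reflect]⟩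
  · intro hp
    rw [Submodule.mem_span_singleton] at hp
    obtain ⟨c, rfl⟩ := hp
    have hdeg : c • Polynomial.reflect k m ∈ Polynomial.degreeLT K (k + 1) := Submodule.smul_mem _ c (hrefl hmk)
    rw [mem_recSpace_rev_iff K k q hdeg, reflect_smul, polynomial_reflect_reflect, hm]
    exact Submodule.smul_mem _ c (Submodule.mem_span_singleton_self m)

/-- **the minimal-recurrence line of `rev_N q` is the reflected line**: for `R(q) = r` and `Rec_r(q) = K · m`, `Rec_r(rev_N q) = K · reflect_r m` and `R(rev_N q) = r`. -/
theorem recSpace_rev_self_eq_span_reflect {r : ℕ} {q : ℕ → K} {m : K[X]} (hq : (hankel1 K N (N / 2) q).rank = r) (hm : recSpace K N q r = K ∙ m) :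
    (hankel1 K N (N / 2) (rev K N q)).rank = r ∧ recSpace K N (rev K N q) r = K ∙ Polynomial.reflect r m := by
  refine ⟨by rw [rank_hankel1_half_rev, hq], recSpace_rev_eq_span_reflect K hm ?_⟩
  exact natDegree_le_of_mem_recSpace K (N := N) (q := q) (by rw [hm]; exact Submodule.mem_span_singleton_self m)

/-! ## §525. The multiplicity of the root `0` of the minimal recurrence is the degree drop after inversion -/

/-- coefficient bookkeeping: for `deg m ≤ r` and `e ≤ r`, **`deg(reflect_r m) + e ≤ r ↔ X^e ∣ m`** (the top `e` coefficients of the reflection are the bottom `e` coefficients of `m`). -/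
theorem natDegree_reflect_add_le_iff_X_pow_dvd {r e : ℕ} {m : K[X]} (hmr : m.natDegree ≤ r) (her : e ≤ r) :
    (Polynomial.reflect r m).natDegree + e ≤ r ↔ Polynomial.X ^ e ∣ m := by
  rw [Polynomial.X_pow_dvd_iff]
  constructor
  · intro h d hd
    have hcoeff : (Polynomial.reflect r m).coeff (r - d) = 0 := Polynomial.coeff_eq_zero_of_natDegree_lt (by omega)
    rwa [Polynomial.coeff_reflect, Polynomial.revAt_le (by omega), show r - (r - d) = d by omega] at hcoeff
  · intro h
    have hle : (Polynomial.reflect r m).natDegree ≤ r - e := by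
      rw [Polynomial.natDegree_le_iff_coeff_eq_zero]
      intro j hj
      rw [Polynomial.coeff_reflect]
      rcases le_or_gt j r with hjr | hjr
      · rw [Polynomial.revAt_le hjr]
        exact h (r - j) (by omega)
      · rw [Polynomial.revAt, Function.Embedding.coeFn_mk, if_neg (by omega)]
        exact Polynomial.coeff_eq_zero_of_natDegree_lt (by omega)
    omega

/-- **THE NODE `0` OF `q` IS THE NODE `∞` OF `rev_N q`, WITH MULTIPLICITY: for `R(q) = r`, `2r ≤ N + 1`, `0 ≠ m ∈ Rec_r(q)` and `e ≤ r`, `X^e ∣ m` iff `rev_N q` has a non-zero recurrence of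
window `r + 1` and degree `≤ r − e`** (a minimal recurrence dropping `e` degrees below `R(rev_N q) = r` — a polar part of order `≥ e` at infinity). -/
theorem X_pow_dvd_iff_exists_mem_recSpace_rev {r e : ℕ} {q : ℕ → K} {m : K[X]} (hq : (hankel1 K N (N / 2) q).rank = r) (h2r : r + r ≤ N + 1)
    (hm : m ∈ recSpace K N q r) (hm0 : m ≠ 0) (her : e ≤ r) :
    Polynomial.X ^ e ∣ m ↔ ∃ p ∈ recSpace K N (rev K N q) r, p ≠ 0 ∧ p.natDegree + e ≤ r := by
  -- `Rec_r(q) = K · m`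
  obtain ⟨m₀, hm₀0, hspan⟩ := exists_recSpace_self_eq_span K hq h2r
  have hline : recSpace K N q r = K ∙ m := by
    rw [hspan] at hm ⊢
    obtain ⟨c, rfl⟩ := Submodule.mem_span_singleton.mp hm
    have hc : c ≠ 0 := by rintro rfl; exact hm0 (zero_smul _ _)
    exact (Submodule.span_singleton_smul_eq (IsUnit.mk0 c hc) m₀).symm
  have hmr : m.natDegree ≤ r := natDegree_le_of_mem_recSpace K hm
  have hrev := recSpace_rev_eq_span_reflect K hline hmr
  rw [← natDegree_reflect_add_le_iff_X_pow_dvd K hmr her]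
  constructor
  · intro h
    refine ⟨Polynomial.reflect r m, by rw [hrev]; exact Submodule.mem_span_singleton_self _, ?_, h⟩
    intro h0
    exact hm0 (by rw [← polynomial_reflect_reflect K r m, h0, Polynomial.reflect_zero])
  · rintro ⟨p, hp, hp0, hpe⟩
    rw [hrev, Submodule.mem_span_singleton] at hp
    obtain ⟨c, rfl⟩ := hp
    have hc : c ≠ 0 := by rintro rfl; exact hp0 (zero_smul _ _)
    rwa [Polynomial.natDegree_smul _ hc] at hpe

end Summit.Ventures.HSemireg.Wedge.HankelOuter
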